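import Summits.ValiantsHypothesis.ValiantsHypothesis.Theorems.BarrierLeverPartitionMinorsHitByVPHiddenStatesShadowRankPairs

/-!
# Route BarrierLever — item `PartitionMinorsHitByVP` (stmt-ValiantsHypothesis-19717), line `hidden_states`:
# THE TRIPLE SPAN BOUND, part A — the level-3 column-functions, the relations of the states, the spanning family

Helper file (`--supports stmt-ValiantsHypothesis-19717`; cell valiant-natproofs, rung V4, 𝒟-side door (c), line
`hidden_states`, node #1 `stub_universalJoinWide`; prover seat val-np-p3 gen 19). Definition-free apart from bookkeeping
`def`s (the level-3 column-functions and the index/vectors of a spanning family). Closes NO item: with part B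
(`…HiddenStatesShadowRankTriples`: rows in the span, the count, `det_eq_zero_triples`) it is the level-3 term
of the KOSZUL-TYPE SPAN LAW (memo HOME/val-np-p3/g19/MEMO-hybrid-valnp3-g19.md §9b: for a complete level-`t` block on `m`
states the column-functions span EXACTLY `C(m,t) − max(0, [zᵗ](1+z)ᵐ(1−z)ᴺ)` dimensions in every computed case; the
pair file `…ShadowRankPairs` proves the `t = 2` bound `nN − C(N,2)`, this file the `t = 3` bound).

THE BOUND. One table, hidden family `e` whose three-state members live inside `S` (`|S| = n`), rows `u i ⊆ T` of size
`≤ s < 3(q+1)`, `N := #{V ⊆ T : |V| ≤ q}`. By part 1 (`prod_eq_sum_coef`, `t = 3`) every row restricted to the triple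
columns is a combination of `Ψ₃_{A,V} : J ↦ [A ⊂ J]·β_{J∖A}(V)` (`A` a 2-set). In the coordinates `r` of `…ShadowRankPairs`
(`exists_coords`: `β_p = Σ_{p₀∈S₀} r(p,p₀)β_{p₀}`, `r = δ` on `S₀`, `|S₀| = e ≤ N`), `Ψ₃_{A,V} = Σ_{p₀} β_{p₀}(V)·Ψ₃''_{A,p₀}` and
the relations `Σ_{b} r(b,p₁)Ψ₃''_{{a,b},p₂} = Σ_b r(b,p₂)Ψ₃''_{{a,b},p₁}` (one family per state `a` — the `Λ²`-valued
relations of the Koszul complex; `psi3_relation`) leave the spanning family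
  `{Ψ₃''_{A,p₀} : A ⊆ S∖S₀} ∪ {Ψ₃''_{{a,p},p₀} : a ∉ S₀, p ≤ p₀ ∈ S₀} ∪ {Ψ₃''_{T∖max T, max T} : T ⊆ S₀, |T| = 3}`
of size `C(n−e,2)e + (n−e)C(e+1,2) + C(e,3)`, which is `≤ C(n,2)N − nC(N,2) + C(N,3)` when `e ≤ N ≤ n` and `N ≤ C(n−N,2)`
(`kept_le`; the triple syzygies `Λ³` are the `C(e,3)`). Hence (`det_eq_zero_triples`): if
  `#{k : |e k| ≠ 3} + C(n,2)·N + C(N,3) < #columns + n·C(N,2)`,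
the matrix is SINGULAR FOR EVERY TABLE. Example: 5-rows (`q = 1`, `N = h+1`), a complete triple block on `m` states is
singular once `[z³](1+z)ᵐ(1−z)^{h+1} > 0`, e.g. `h = 14`, `m ≥ 29`. WHAT THIS IS NOT: no lower bound on the rank; the
measured TOTAL 3-fold law of a flat piece has an extra cross-level loss (memo §9c) not captured by block bounds; nothing
on crux 14610 or VP ≠ VNP.
-/

set_option linter.dupNamespace false

namespace Summit.ValiantsHypothesis.ValiantsHypothesis.Theorems.BarrierLever.HiddenStates

open Finset

noncomputable section

namespace ShadowRank

variable {K h : ℕ} {n : Type*}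

/-! ## Level-3 column-functions and the spanning family -/

/-- `Ψ₃_{A,V}`: on a triple column containing the 2-set `A`, the feature `V` of the third state. -/
def Psi3 (e : n → Finset (Fin K)) (tx : Option (Fin K) → Fin h → ℂ) (A : Finset (Fin K)) (V : Finset (Fin h)) :
    n → ℂ :=
  fun k => if (e k).card = 3 ∧ A ⊆ e k then ∑ c ∈ e k \ A, feat tx c V else 0

/-- `Ψ₃''_{A,p₀}`: on a triple column containing the 2-set `A`, the `p₀`-coordinate of the third state. -/
def psi3 (e : n → Finset (Fin K)) (r : Fin K → Fin K → ℂ) (A : Finset (Fin K)) (p₀ : Fin K) : n → ℂ :=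
  fun k => if (e k).card = 3 ∧ A ⊆ e k then ∑ c ∈ e k \ A, r c p₀ else 0

/-- Index of the spanning family: off-level columns; 2-sets outside `S₀` × `S₀`; (state outside `S₀`) × `S₀.sym2`;
3-subsets of `S₀`. -/
abbrev TIdx (e : n → Finset (Fin K)) (S S₀ : Finset (Fin K)) :=
  {k : n // (e k).card ≠ 3} ⊕ ((↥((S \ S₀).powersetCard 2) × ↥S₀) ⊕ ((↥(S \ S₀) × ↥(S₀.sym2)) ⊕ ↥(S₀.powersetCard 3)))

/-- `Ψ₃''_{{a,p},p₀}` on an unordered pair `{p, p₀}` of `S₀`, oriented `p ≤ p₀`. -/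
def psi3Sym (e : n → Finset (Fin K)) (r : Fin K → Fin K → ℂ) (a : Fin K) : Sym2 (Fin K) → (n → ℂ) :=
  Sym2.lift ⟨fun p p₀ => psi3 e r {a, min p p₀} (max p p₀), fun p p₀ => by
    dsimp only
    rw [min_comm, max_comm]⟩

/-- The spanning family. -/
def famVec3 [DecidableEq n] (e : n → Finset (Fin K)) (S S₀ : Finset (Fin K)) (r : Fin K → Fin K → ℂ) :
    TIdx e S S₀ → (n → ℂ)
  | Sum.inl k₀ => fun k => if k = k₀.1 then 1 else 0
  | Sum.inr (Sum.inl (A, p₀)) => psi3 e r A.1 p₀.1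
  | Sum.inr (Sum.inr (Sum.inl (a, z))) => psi3Sym e r a.1 z.1
  | Sum.inr (Sum.inr (Sum.inr T)) =>
      if hT : T.1.Nonempty then psi3 e r (T.1.erase (T.1.max' hT)) (T.1.max' hT) else 0

/-! ## The relations and the span of the reduced column-functions -/

section relations

variable [DecidableEq n] (e : n → Finset (Fin K)) (S S₀ : Finset (Fin K)) (r : Fin K → Fin K → ℂ)
  (heS : ∀ k, (e k).card = 3 → e k ⊆ S) (hS₀ : S₀ ⊆ S)
  (hδ : ∀ p ∈ S₀, ∀ p₀, r p p₀ = if p = p₀ then 1 else 0)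

omit [DecidableEq n] in
/-- `{a, b} ⊆ J` and the third states. -/
theorem sdiff_pair_eq (J : Finset (Fin K)) (a b : Fin K) : J \ {a, b} = (J.erase a).erase b := by
  ext c
  simp only [Finset.mem_sdiff, Finset.mem_insert, Finset.mem_singleton, not_or, Finset.mem_erase]
  tauto

omit [DecidableEq n] in
include heS in
/-- **The relation of the state `a`**: `Σ_b r(b,p₁) Ψ₃''_{{a,b},p₂} = Σ_b r(b,p₂) Ψ₃''_{{a,b},p₁}`. -/
theorem psi3_relation (a p₁ p₂ : Fin K) (k : n) :
    ∑ b ∈ S.erase a, r b p₁ * psi3 e r {a, b} p₂ k = ∑ b ∈ S.erase a, r b p₂ * psi3 e r {a, b} p₁ k := by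
  classical
  by_cases hk : (e k).card = 3 ∧ a ∈ e k
  · have hsub : (e k).erase a ⊆ S.erase a := Finset.erase_subset_erase a (heS k hk.1)
    have hred : ∀ p₁ p₂ : Fin K, ∑ b ∈ S.erase a, r b p₁ * psi3 e r {a, b} p₂ k =
        ∑ b ∈ (e k).erase a, ∑ c ∈ ((e k).erase a).erase b, r b p₁ * r c p₂ := by
      intro p₁ p₂
      rw [← Finset.sum_subset hsub (fun b hb hb' => ?_)]
      · refine Finset.sum_congr rfl fun b hb => ?_
        have hab : ({a, b} : Finset (Fin K)) ⊆ e k :=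
          Finset.insert_subset hk.2 (Finset.singleton_subset_iff.mpr (Finset.mem_of_mem_erase hb))
        rw [psi3, if_pos ⟨hk.1, hab⟩, sdiff_pair_eq, Finset.mul_sum]
      · have hab : ¬ ({a, b} : Finset (Fin K)) ⊆ e k := fun h' =>
          hb' (Finset.mem_erase.mpr ⟨(Finset.mem_erase.mp hb).1, h' (by simp)⟩)
        simp [psi3, hab]
    rw [hred, hred, Finset.sum_comm' (t' := (e k).erase a) (s' := fun c => ((e k).erase a).erase c)]
    · exact Finset.sum_congr rfl fun b _ => Finset.sum_congr rfl fun c _ => by ring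
    · intro b c
      simp only [Finset.mem_erase]
      tauto
  · have hzero : ∀ b p, psi3 e r {a, b} p k = 0 := by
      intro b p
      have : ¬ ((e k).card = 3 ∧ ({a, b} : Finset (Fin K)) ⊆ e k) := fun h' => hk ⟨h'.1, h'.2 (by simp)⟩
      simp [psi3, this]
    simp [hzero]

omit [DecidableEq n] in
include heS hS₀ hδ in
/-- The relation of `a` split along `S₀`: for `p₁, p₂ ∈ S₀`,
`[a ≠ p₁]Ψ₃''_{{a,p₁},p₂} − [a ≠ p₂]Ψ₃''_{{a,p₂},p₁}` is a combination of the `Ψ₃''_{{a,b},·}`, `b ∉ S₀`. -/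
theorem psi3_split (a p₁ p₂ : Fin K) (hp₁ : p₁ ∈ S₀) (hp₂ : p₂ ∈ S₀) :
    (if a = p₁ then 0 else psi3 e r {a, p₁} p₂) - (if a = p₂ then 0 else psi3 e r {a, p₂} p₁) =
      ∑ b ∈ (S \ S₀).erase a, (r b p₂ • psi3 e r {a, b} p₁ - r b p₁ • psi3 e r {a, b} p₂) := by
  classical
  funext k
  have hrel := psi3_relation e S r heS a p₁ p₂ k
  have hsplit : S.erase a = S₀.erase a ∪ (S \ S₀).erase a := by
    ext b
    have hbS : b ∈ S₀ → b ∈ S := fun h' => hS₀ h'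
    simp only [Finset.mem_erase, Finset.mem_union, Finset.mem_sdiff]
    tauto
  have hdisj : Disjoint (S₀.erase a) ((S \ S₀).erase a) := by
    rw [Finset.disjoint_left]; intro b hb hb'
    exact (Finset.mem_sdiff.mp (Finset.mem_of_mem_erase hb')).2 (Finset.mem_of_mem_erase hb)
  rw [hsplit, Finset.sum_union hdisj, Finset.sum_union hdisj] at hrel
  -- the `S₀`-parts are single terms
  have h1 : ∑ b ∈ S₀.erase a, r b p₁ * psi3 e r {a, b} p₂ k =
      (if a = p₁ then 0 else psi3 e r {a, p₁} p₂) k := by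
    rw [Finset.sum_congr rfl fun b hb => by rw [hδ b (Finset.mem_of_mem_erase hb) p₁]]
    by_cases hap : a = p₁
    · rw [if_pos hap]
      refine Finset.sum_eq_zero fun b hb => ?_
      have : b ≠ p₁ := fun hb' => (Finset.mem_erase.mp hb).1 (hb'.trans hap.symm)
      simp [this]
    · rw [if_neg hap]
      simp only [ite_mul, one_mul, zero_mul, Finset.sum_ite_eq', Finset.mem_erase, ne_eq]
      rw [if_pos ⟨fun h' => hap h'.symm, hp₁⟩]
  have h2 : ∑ b ∈ S₀.erase a, r b p₂ * psi3 e r {a, b} p₁ k =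
      (if a = p₂ then 0 else psi3 e r {a, p₂} p₁) k := by
    rw [Finset.sum_congr rfl fun b hb => by rw [hδ b (Finset.mem_of_mem_erase hb) p₂]]
    by_cases hap : a = p₂
    · rw [if_pos hap]
      refine Finset.sum_eq_zero fun b hb => ?_
      have : b ≠ p₂ := fun hb' => (Finset.mem_erase.mp hb).1 (hb'.trans hap.symm)
      simp [this]
    · rw [if_neg hap]
      simp only [ite_mul, one_mul, zero_mul, Finset.sum_ite_eq', Finset.mem_erase, ne_eq]
      rw [if_pos ⟨fun h' => hap h'.symm, hp₂⟩]
  rw [h1, h2] at hrel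
  simp only [Pi.sub_apply, Finset.sum_apply, Pi.smul_apply, smul_eq_mul, Finset.sum_sub_distrib]
  linear_combination hrel

include heS hS₀ hδ in
/-- Every reduced column-function `Ψ₃''_{{x,y},p₀}` (`x ≠ y` in `S`, `p₀ ∈ S₀`) lies in the span of the family. -/
theorem psi3_mem_span (x y p₀ : Fin K) (hx : x ∈ S) (hy : y ∈ S) (hxy : x ≠ y) (hp₀ : p₀ ∈ S₀) :
    psi3 e r {x, y} p₀ ∈ Submodule.span ℂ (Set.range (famVec3 e S S₀ r)) := by
  classical
  set W := Submodule.span ℂ (Set.range (famVec3 e S S₀ r)) with hW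
  have hpair_comm : ∀ a b : Fin K, ({a, b} : Finset (Fin K)) = {b, a} := fun a b => Finset.pair_comm a b
  -- type 0: both states outside `S₀`
  have h0 : ∀ a ∈ S \ S₀, ∀ b ∈ S \ S₀, a ≠ b → ∀ p ∈ S₀, psi3 e r {a, b} p ∈ W := by
    intro a ha b hb hab p hp
    have hA : ({a, b} : Finset (Fin K)) ∈ (S \ S₀).powersetCard 2 :=
      Finset.mem_powersetCard.mpr ⟨Finset.insert_subset ha (Finset.singleton_subset_iff.mpr hb),
        Finset.card_pair hab⟩
    exact Submodule.subset_span ⟨Sum.inr (Sum.inl (⟨{a, b}, hA⟩, ⟨p, hp⟩)), rfl⟩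
  -- the right-hand sides of `psi3_split` with `a ∉ S₀` are in `W`
  have hNS0 : ∀ a ∈ S \ S₀, ∀ p₁ ∈ S₀, ∀ p₂ ∈ S₀,
      ∑ b ∈ (S \ S₀).erase a, (r b p₂ • psi3 e r {a, b} p₁ - r b p₁ • psi3 e r {a, b} p₂) ∈ W := by
    intro a ha p₁ hp₁ p₂ hp₂
    refine Submodule.sum_mem _ fun b hb => ?_
    have hb' := Finset.mem_erase.mp hb
    exact Submodule.sub_mem _ (Submodule.smul_mem _ _ (h0 a ha b hb'.2 (Ne.symm hb'.1) p₁ hp₁))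
      (Submodule.smul_mem _ _ (h0 a ha b hb'.2 (Ne.symm hb'.1) p₂ hp₂))
  -- type 1: `a ∉ S₀`, `p, p₀ ∈ S₀`
  have h1 : ∀ a ∈ S \ S₀, ∀ p ∈ S₀, ∀ p' ∈ S₀, psi3 e r {a, p} p' ∈ W := by
    intro a ha p hp p' hp'
    have hmem : ∀ c ∈ S₀, ∀ d ∈ S₀, c ≤ d → psi3 e r {a, c} d ∈ W := by
      intro c hc d hd hcd
      refine Submodule.subset_span ⟨Sum.inr (Sum.inr (Sum.inl (⟨a, ha⟩, ⟨s(c, d),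
        Finset.mk_mem_sym2_iff.mpr ⟨hc, hd⟩⟩))), ?_⟩
      simp [famVec3, psi3Sym, Sym2.lift_mk, min_eq_left hcd, max_eq_right hcd]
    rcases le_or_gt p p' with hle | hlt
    · exact hmem p hp p' hp' hle
    · -- swap with the relation of `a` (note `a ≠ p, p'` since `a ∉ S₀`)
      have hap : a ≠ p := fun h' => (Finset.mem_sdiff.mp ha).2 (h' ▸ hp)
      have hap' : a ≠ p' := fun h' => (Finset.mem_sdiff.mp ha).2 (h' ▸ hp')
      have hs := psi3_split e S S₀ r heS hS₀ hδ a p' p hp' hp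
      rw [if_neg hap', if_neg hap] at hs
      have : psi3 e r {a, p} p' = psi3 e r {a, p'} p -
          ∑ b ∈ (S \ S₀).erase a, (r b p • psi3 e r {a, b} p' - r b p' • psi3 e r {a, b} p) := by
        rw [← hs]; ring
      rw [this]
      exact Submodule.sub_mem _ (hmem p' hp' p hp hlt.le) (hNS0 a ha p' hp' p hp)
  -- the right-hand sides of `psi3_split` with `a ∈ S₀` are in `W`
  have hNS1 : ∀ a ∈ S₀, ∀ p₁ ∈ S₀, ∀ p₂ ∈ S₀,
      ∑ b ∈ (S \ S₀).erase a, (r b p₂ • psi3 e r {a, b} p₁ - r b p₁ • psi3 e r {a, b} p₂) ∈ W := by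
    intro a ha p₁ hp₁ p₂ hp₂
    refine Submodule.sum_mem _ fun b hb => ?_
    have hb' := (Finset.mem_erase.mp hb).2
    rw [hpair_comm a b]
    exact Submodule.sub_mem _ (Submodule.smul_mem _ _ (h1 b hb' a ha p₁ hp₁))
      (Submodule.smul_mem _ _ (h1 b hb' a ha p₂ hp₂))
  -- type 2: both states in `S₀`
  have h2 : ∀ a ∈ S₀, ∀ b ∈ S₀, a ≠ b → ∀ p ∈ S₀, psi3 e r {a, b} p ∈ W := by
    intro a ha b hb hab p hp
    by_cases hpa : p = a
    · -- coordinate inside the pair: relation of `a` with `(p₁, p₂) = (a, b)`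
      subst hpa
      have hs := psi3_split e S S₀ r heS hS₀ hδ p p b ha hb
      rw [if_pos rfl, if_neg hab, zero_sub] at hs
      have : psi3 e r {p, b} p = -∑ b' ∈ (S \ S₀).erase p,
          (r b' b • psi3 e r {p, b'} p - r b' p • psi3 e r {p, b'} b) := by rw [← hs]; ring
      rw [this]
      exact Submodule.neg_mem _ (hNS1 p ha p ha b hb)
    by_cases hpb : p = b
    · subst hpb
      have hs := psi3_split e S S₀ r heS hS₀ hδ p a p ha hb
      rw [if_neg (Ne.symm hab), if_pos rfl, sub_zero] at hs
      rw [hpair_comm a p, hs]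
      exact hNS1 p hb a ha p hb
    -- coordinate outside the pair: orient by the maximum of the triple
    have hmax : ∀ c ∈ S₀, ∀ d ∈ S₀, ∀ m ∈ S₀, c < m → d < m → c ≠ d → psi3 e r {c, d} m ∈ W := by
      intro c hc d hd m hm hcm hdm hcd
      have hT : ({c, d, m} : Finset (Fin K)) ∈ S₀.powersetCard 3 := by
        rw [Finset.mem_powersetCard]
        refine ⟨?_, ?_⟩
        · intro z hz
          simp only [Finset.mem_insert, Finset.mem_singleton] at hz
          rcases hz with rfl | rfl | rfl <;> assumption
        · rw [Finset.card_insert_of_notMem (by simp [hcd, hcm.ne]), Finset.card_pair hdm.ne]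
      refine Submodule.subset_span ⟨Sum.inr (Sum.inr (Sum.inr ⟨{c, d, m}, hT⟩)), ?_⟩
      have hne : ({c, d, m} : Finset (Fin K)).Nonempty := ⟨c, by simp⟩
      have hmx : ({c, d, m} : Finset (Fin K)).max' hne = m := by
        apply le_antisymm
        · apply Finset.max'_le; intro z hz
          simp only [Finset.mem_insert, Finset.mem_singleton] at hz
          rcases hz with rfl | rfl | rfl
          · exact hcm.le
          · exact hdm.le
          · exact le_rfl
        · exact Finset.le_max' _ _ (by simp)
      have her : ({c, d, m} : Finset (Fin K)).erase m = {c, d} := by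
        ext z
        simp only [Finset.mem_erase, Finset.mem_insert, Finset.mem_singleton]
        constructor
        · rintro ⟨hzm, hz⟩; tauto
        · rintro (rfl | rfl)
          · exact ⟨hcm.ne, Or.inl rfl⟩
          · exact ⟨hdm.ne, Or.inr (Or.inl rfl)⟩
      simp only [famVec3, dif_pos hne, hmx, her]
    -- the three cases for the position of the maximum
    rcases lt_trichotomy p (max a b) with hlt | heq | hgt
    · -- the maximum `M` is in the pair: swap it with the coordinate via the relation of the other state `u`
      have key : ∀ u M : Fin K, u ∈ S₀ → M ∈ S₀ → u < M → p < M → u ≠ p →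
          psi3 e r {u, M} p ∈ W := by
        intro u M hu hM huM hpM hup
        have hs := psi3_split e S S₀ r heS hS₀ hδ u p M hp hM
        rw [if_neg hup, if_neg huM.ne] at hs
        have : psi3 e r {u, M} p = psi3 e r {u, p} M -
            ∑ b' ∈ (S \ S₀).erase u, (r b' M • psi3 e r {u, b'} p - r b' p • psi3 e r {u, b'} M) := by
          rw [← hs]; ring
        rw [this]
        exact Submodule.sub_mem _ (hmax u hu p hp M hM huM hpM hup) (hNS1 u hu p hp M hM)
      rcases le_total a b with hab' | hab'
      · rw [max_eq_right hab'] at hlt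
        exact key a b ha hb (lt_of_le_of_ne hab' hab) hlt (Ne.symm hpa)
      · rw [max_eq_left hab'] at hlt
        rw [hpair_comm]
        exact key b a hb ha (lt_of_le_of_ne hab' (Ne.symm hab)) hlt (Ne.symm hpb)
    · rcases max_choice a b with h' | h'
      · exact absurd (heq.trans h') hpa
      · exact absurd (heq.trans h') hpb
    · exact hmax a ha b hb p hp (lt_of_le_of_lt (le_max_left a b) hgt) (lt_of_le_of_lt (le_max_right a b) hgt) hab
  -- assemble
  by_cases hxS : x ∈ S₀ <;> by_cases hyS : y ∈ S₀
  · exact h2 x hxS y hyS hxy p₀ hp₀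
  · rw [hpair_comm]; exact h1 y (Finset.mem_sdiff.mpr ⟨hy, hyS⟩) x hxS p₀ hp₀
  · exact h1 x (Finset.mem_sdiff.mpr ⟨hx, hxS⟩) y hyS p₀ hp₀
  · exact h0 x (Finset.mem_sdiff.mpr ⟨hx, hxS⟩) y (Finset.mem_sdiff.mpr ⟨hy, hyS⟩) hxy p₀ hp₀

end relations

end ShadowRank

end

end Summit.ValiantsHypothesis.ValiantsHypothesis.Theorems.BarrierLever.HiddenStates
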